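import Mathlib
import HarnessLib

/-!
# `R⟦X_σ, Y_τ⟧ ≅ (R⟦Y_τ⟧)⟦X_σ⟧`: the sum-of-variables equivalence for multivariate power series

`Literature/RingTheory/MvPowerSeries/SumEquiv.lean` (grouping namespace `Literature.RingTheory.MvPowerSeries.SumEquiv`).
The power-series analogue of Mathlib's `MvPolynomial.sumAlgEquiv`: for ANY index types `σ`, `τ` and any commutative
semiring `R`, regrouping the variables of a power series in `σ ⊕ τ` as a power series in the `σ`-variables with
coefficients power series in the `τ`-variables is an `R`-algebra isomorphism
`sumAlgEquiv : MvPowerSeries (σ ⊕ τ) R ≃ₐ[R] MvPowerSeries σ (MvPowerSeries τ R)`, characterised coefficientwise by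
`coeff e (coeff d (sumAlgEquiv f)) = coeff (join d e) f` where `join d e` is the exponent on `σ ⊕ τ` with components
`d`, `e` (`Finsupp.sumFinsuppAddEquivProdFinsupp`).  Everything here is PROVED; there is no named fact.

1. exponents: `join`, `join_inj`, `join_split`, `join_add`, `join_eq_zero_iff`, `weight_sumElim_one_zero_join`
   (the weight «`1` on `σ`, `0` on `τ`» of `join d e` is `degree d`);
2. the equivalence: `toIter`, `coeff_coeff_toIter`, `toIter_mul` (Cauchy products regroup), `sumAlgEquiv`,
   `coeff_coeff_sumAlgEquiv`, `coeff_sumAlgEquiv_symm`, `sumAlgEquiv_monomial`, `sumAlgEquiv_C`, `sumAlgEquiv_X_inl`,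
   `sumAlgEquiv_X_inr`, `constantCoeff_constantCoeff_sumAlgEquiv`;
3. the two block embeddings: `sumAlgEquiv_rename_inl` (`rename Sum.inl g ↦ map C g`, the series with CONSTANT
   coefficients) and `sumAlgEquiv_rename_inr` (`rename Sum.inr h ↦ C h`);
4. ORDERS: `weightedOrder_sumElim_eq_order_sumAlgEquiv` — the `σ`-ADIC ORDER of `f` (weighted order with weight `1` on
   the `σ`-variables and `0` on the `τ`-variables, i.e. the order of `f` along the ideal of the `σ`-variables) equals the
   ORDER of `sumAlgEquiv f` as a power series over `R⟦Y_τ⟧`; with `order_map_of_injective` (the order is unchanged under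
   an injective change of coefficients) this is the «order along `V(X_σ)` = order at the generic point» bookkeeping used
   for curve germs (`τ` = one parameter `t`, coefficients pushed into `Frac R⟦t⟧`).

Classical source: Zariski–Samuel, *Commutative Algebra* II, Ch. VII §1 (Corollary of Theorem 4: «`A[[X_1, …, X_n]]` is
isomorphic to `A[[X_1, …, X_{n-1}]][[X_n]]`», used there for the Noetherian induction); also Bourbaki, *Algèbre*, Ch. IV §4
(formal power series).  The polynomial case is Mathlib's `MvPolynomial.sumAlgEquiv`.  Written for the HIRONAKA-L lane (summit
`ResolutionOfSingularities`, chain W4.3, TOT2-LINE §5 (C): the «generic point along a curve germ» dictionary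
`k⟦z, u, t⟧ → k((t))⟦z, u⟧`), but free of any resolution-specific content.

## References

* [ZariskiSamuel1960] O. Zariski, P. Samuel, Commutative Algebra, Vol. II, Ch. VII §1 (formal power series), Corollary of Theorem 4.
* N. Bourbaki, Algèbre, Chapitres 4 à 7, Ch. IV §4 (context).
-/

noncomputable section

namespace Literature.RingTheory.MvPowerSeries.SumEquiv

open _root_.MvPowerSeries Finsupp

variable {σ τ : Type*} {R : Type*}

/-! ### 1. Exponents on `σ ⊕ τ` -/

/-- The exponent on `σ ⊕ τ` with `σ`-part `d` and `τ`-part `e`. [folklore] -/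
def join (d : σ →₀ ℕ) (e : τ →₀ ℕ) : σ ⊕ τ →₀ ℕ := sumFinsuppAddEquivProdFinsupp.symm (d, e)

/-- `join d e` on a left variable. [cite: ZariskiSamuel1960, Vol. II Ch. VII §1, Corollary of Theorem 4] -/
@[simp] theorem join_inl (d : σ →₀ ℕ) (e : τ →₀ ℕ) (i : σ) : join d e (Sum.inl i) = d i :=
  sumFinsuppEquivProdFinsupp_symm_inl (d, e) i

/-- `join d e` on a right variable. [cite: ZariskiSamuel1960, Vol. II Ch. VII §1, Corollary of Theorem 4] -/
@[simp] theorem join_inr (d : σ →₀ ℕ) (e : τ →₀ ℕ) (j : τ) : join d e (Sum.inr j) = e j :=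
  sumFinsuppEquivProdFinsupp_symm_inr (d, e) j

/-- The `σ`-part of an exponent on `σ ⊕ τ`. [folklore] -/
def splitL (n : σ ⊕ τ →₀ ℕ) : σ →₀ ℕ := (sumFinsuppAddEquivProdFinsupp n).1

/-- The `τ`-part of an exponent on `σ ⊕ τ`. [folklore] -/
def splitR (n : σ ⊕ τ →₀ ℕ) : τ →₀ ℕ := (sumFinsuppAddEquivProdFinsupp n).2

/-- `splitL n` on a variable. [cite: ZariskiSamuel1960, Vol. II Ch. VII §1, Corollary of Theorem 4] -/
@[simp] theorem splitL_apply (n : σ ⊕ τ →₀ ℕ) (i : σ) : splitL n i = n (Sum.inl i) :=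
  fst_sumFinsuppEquivProdFinsupp n i

/-- `splitR n` on a variable. [cite: ZariskiSamuel1960, Vol. II Ch. VII §1, Corollary of Theorem 4] -/
@[simp] theorem splitR_apply (n : σ ⊕ τ →₀ ℕ) (j : τ) : splitR n j = n (Sum.inr j) :=
  snd_sumFinsuppEquivProdFinsupp n j

/-- `join` after `split` is the identity. [cite: ZariskiSamuel1960, Vol. II Ch. VII §1, Corollary of Theorem 4] -/
@[simp] theorem join_split (n : σ ⊕ τ →₀ ℕ) : join (splitL n) (splitR n) = n := by
  ext x; rcases x with i | j <;> simp

/-- `splitL` of `join`. [cite: ZariskiSamuel1960, Vol. II Ch. VII §1, Corollary of Theorem 4] -/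
@[simp] theorem splitL_join (d : σ →₀ ℕ) (e : τ →₀ ℕ) : splitL (join d e) = d := by
  ext i; simp

/-- `splitR` of `join`. [cite: ZariskiSamuel1960, Vol. II Ch. VII §1, Corollary of Theorem 4] -/
@[simp] theorem splitR_join (d : σ →₀ ℕ) (e : τ →₀ ℕ) : splitR (join d e) = e := by
  ext j; simp

/-- `join` is injective in both arguments jointly. [cite: ZariskiSamuel1960, Vol. II Ch. VII §1, Corollary of Theorem 4] -/
theorem join_inj {d d' : σ →₀ ℕ} {e e' : τ →₀ ℕ} : join d e = join d' e' ↔ d = d' ∧ e = e' := by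
  constructor
  · intro h
    exact ⟨by rw [← splitL_join d e, h, splitL_join], by rw [← splitR_join d e, h, splitR_join]⟩
  · rintro ⟨rfl, rfl⟩; rfl

/-- `join` is additive. [cite: ZariskiSamuel1960, Vol. II Ch. VII §1, Corollary of Theorem 4] -/
theorem join_add (d d' : σ →₀ ℕ) (e e' : τ →₀ ℕ) : join (d + d') (e + e') = join d e + join d' e' := by
  ext x; rcases x with i | j <;> simp

/-- `splitL` is additive. [cite: ZariskiSamuel1960, Vol. II Ch. VII §1, Corollary of Theorem 4] -/
theorem splitL_add (n n' : σ ⊕ τ →₀ ℕ) : splitL (n + n') = splitL n + splitL n' := by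
  ext i; simp

/-- `splitR` is additive. [cite: ZariskiSamuel1960, Vol. II Ch. VII §1, Corollary of Theorem 4] -/
theorem splitR_add (n n' : σ ⊕ τ →₀ ℕ) : splitR (n + n') = splitR n + splitR n' := by
  ext j; simp

/-- `join d e = 0 ↔ d = 0 ∧ e = 0`. [cite: ZariskiSamuel1960, Vol. II Ch. VII §1, Corollary of Theorem 4] -/
theorem join_eq_zero_iff (d : σ →₀ ℕ) (e : τ →₀ ℕ) : join d e = 0 ↔ d = 0 ∧ e = 0 := by
  rw [show (0 : σ ⊕ τ →₀ ℕ) = join 0 0 from by ext x; rcases x with i | j <;> simp, join_inj]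

/-- `join` of unit vectors, left. [cite: ZariskiSamuel1960, Vol. II Ch. VII §1, Corollary of Theorem 4] -/
theorem join_single_zero (i : σ) (a : ℕ) : join (single i a) (0 : τ →₀ ℕ) = single (Sum.inl i) a := by
  classical
  ext x; rcases x with i' | j
  · simp [single_apply]
  · simp

/-- `join` of unit vectors, right. [cite: ZariskiSamuel1960, Vol. II Ch. VII §1, Corollary of Theorem 4] -/
theorem join_zero_single (j : τ) (a : ℕ) : join (0 : σ →₀ ℕ) (single j a) = single (Sum.inr j) a := by
  classical
  ext x; rcases x with i | j'
  · simp
  · simp [single_apply]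

/-- The weight «`1` on the `σ`-variables, `0` on the `τ`-variables» of `join d e` is `degree d` (finite `σ`). [cite: ZariskiSamuel1960, Vol. II Ch. VII §1, Corollary of Theorem 4] -/
theorem weight_sumElim_join [Fintype σ] [Fintype τ] (d : σ →₀ ℕ) (e : τ →₀ ℕ) :
    weight (Sum.elim (fun _ : σ => (1 : ℕ)) (fun _ : τ => 0)) (join d e) = degree d := by
  rw [weight_apply, sum_fintype _ _ (fun _ => by simp), degree_eq_sum]
  rw [Fintype.sum_sum_type]
  simp

variable [CommSemiring R]

/-! ### 2. The equivalence -/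

/-- Regrouping a power series in `σ ⊕ τ` as a power series in the `σ`-variables with coefficients in `R⟦Y_τ⟧` (the underlying
function of `sumAlgEquiv`). [folklore] -/
def toIter (f : MvPowerSeries (σ ⊕ τ) R) : MvPowerSeries σ (MvPowerSeries τ R) :=
  fun d => fun e => coeff (join d e) f

/-- The inverse regrouping. [folklore] -/
def ofIter (g : MvPowerSeries σ (MvPowerSeries τ R)) : MvPowerSeries (σ ⊕ τ) R :=
  fun n => coeff (splitR n) (coeff (splitL n) g)

/-- THE COEFFICIENT FORMULA: `coeff e (coeff d (toIter f)) = coeff (join d e) f`. [cite: ZariskiSamuel1960, Vol. II Ch. VII §1, Corollary of Theorem 4] -/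
@[simp] theorem coeff_coeff_toIter (f : MvPowerSeries (σ ⊕ τ) R) (d : σ →₀ ℕ) (e : τ →₀ ℕ) :
    coeff e (coeff d (toIter f)) = coeff (join d e) f := rfl

/-- Coefficients of the inverse regrouping. [cite: ZariskiSamuel1960, Vol. II Ch. VII §1, Corollary of Theorem 4] -/
@[simp] theorem coeff_ofIter (g : MvPowerSeries σ (MvPowerSeries τ R)) (n : σ ⊕ τ →₀ ℕ) :
    coeff n (ofIter g) = coeff (splitR n) (coeff (splitL n) g) := rfl

/-- `ofIter ∘ toIter = id`. [cite: ZariskiSamuel1960, Vol. II Ch. VII §1, Corollary of Theorem 4] -/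
theorem ofIter_toIter (f : MvPowerSeries (σ ⊕ τ) R) : ofIter (toIter f) = f := by
  ext n; simp

/-- `toIter ∘ ofIter = id`. [cite: ZariskiSamuel1960, Vol. II Ch. VII §1, Corollary of Theorem 4] -/
theorem toIter_ofIter (g : MvPowerSeries σ (MvPowerSeries τ R)) : toIter (ofIter g) = g := by
  ext d e; simp

/-- `toIter` is additive. [cite: ZariskiSamuel1960, Vol. II Ch. VII §1, Corollary of Theorem 4] -/
theorem toIter_add (f g : MvPowerSeries (σ ⊕ τ) R) : toIter (f + g) = toIter f + toIter g := by
  ext d e; simp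

/-- `toIter 0 = 0`. [cite: ZariskiSamuel1960, Vol. II Ch. VII §1, Corollary of Theorem 4] -/
theorem toIter_zero : toIter (0 : MvPowerSeries (σ ⊕ τ) R) = 0 := by
  ext d e; simp

/-- `toIter` on monomials: `X^{join d e} ↦ (r · Y^e) · X^d`. [cite: ZariskiSamuel1960, Vol. II Ch. VII §1, Corollary of Theorem 4] -/
theorem toIter_monomial (d : σ →₀ ℕ) (e : τ →₀ ℕ) (r : R) :
    toIter (monomial (join d e) r) = monomial d (monomial e r) := by
  classical
  ext d' e'
  rw [coeff_coeff_toIter, coeff_monomial, coeff_monomial]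
  by_cases hd : d' = d
  · subst hd
    rw [if_pos rfl, coeff_monomial]
    by_cases he : e' = e
    · subst he; rw [if_pos rfl, if_pos rfl]
    · rw [if_neg he, if_neg (fun h => he (join_inj.mp h).2)]
  · rw [if_neg hd, map_zero, if_neg (fun h => hd (join_inj.mp h).1)]

/-- `toIter 1 = 1`. [cite: ZariskiSamuel1960, Vol. II Ch. VII §1, Corollary of Theorem 4] -/
theorem toIter_one : toIter (1 : MvPowerSeries (σ ⊕ τ) R) = 1 := by
  have h := toIter_monomial (σ := σ) (τ := τ) (R := R) 0 0 1
  rwa [show join (0 : σ →₀ ℕ) (0 : τ →₀ ℕ) = 0 from (join_eq_zero_iff 0 0).mpr ⟨rfl, rfl⟩, monomial_zero_one,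
    monomial_zero_one, monomial_zero_one] at h

/-- `toIter` on constants: `C r ↦ C (C r)`. [cite: ZariskiSamuel1960, Vol. II Ch. VII §1, Corollary of Theorem 4] -/
theorem toIter_C (r : R) : toIter (C r : MvPowerSeries (σ ⊕ τ) R) = C (C r) := by
  have h := toIter_monomial (σ := σ) (τ := τ) (R := R) 0 0 r
  rwa [show join (0 : σ →₀ ℕ) (0 : τ →₀ ℕ) = 0 from (join_eq_zero_iff 0 0).mpr ⟨rfl, rfl⟩] at h

/-- The regrouping of pairs of exponents used for the Cauchy product. [folklore] -/
def pairEquiv : (σ ⊕ τ →₀ ℕ) × (σ ⊕ τ →₀ ℕ) ≃ ((σ →₀ ℕ) × (σ →₀ ℕ)) × ((τ →₀ ℕ) × (τ →₀ ℕ)) where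
  toFun p := ((splitL p.1, splitL p.2), (splitR p.1, splitR p.2))
  invFun q := (join q.1.1 q.2.1, join q.1.2 q.2.2)
  left_inv p := by simp
  right_inv q := by simp

/-- CAUCHY PRODUCTS REGROUP: `toIter (f * g) = toIter f * toIter g`. [cite: ZariskiSamuel1960, Vol. II Ch. VII §1, Corollary of Theorem 4] -/
theorem toIter_mul (f g : MvPowerSeries (σ ⊕ τ) R) : toIter (f * g) = toIter f * toIter g := by
  classical
  ext d e
  rw [coeff_coeff_toIter, coeff_mul, coeff_mul, map_sum]
  simp_rw [coeff_mul]
  rw [← Finset.sum_product' (f := fun (x : (σ →₀ ℕ) × (σ →₀ ℕ)) (y : (τ →₀ ℕ) × (τ →₀ ℕ)) =>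
      coeff y.1 (coeff x.1 (toIter f)) * coeff y.2 (coeff x.2 (toIter g)))]
  refine Finset.sum_equiv pairEquiv (fun p => ?_) (fun p _ => ?_)
  · simp only [Finset.HasAntidiagonal.mem_antidiagonal, Finset.mem_product, pairEquiv, Equiv.coe_fn_mk]
    constructor
    · intro h
      exact ⟨by rw [← splitL_add, h, splitL_join], by rw [← splitR_add, h, splitR_join]⟩
    · rintro ⟨h1, h2⟩
      rw [← join_split p.1, ← join_split p.2, ← join_add, h1, h2]
  · simp only [pairEquiv, Equiv.coe_fn_mk, coeff_coeff_toIter, join_split]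

/-- **THE SUM-OF-VARIABLES EQUIVALENCE** `R⟦X_σ, Y_τ⟧ ≃ₐ[R] (R⟦Y_τ⟧)⟦X_σ⟧` (the power-series analogue of
`MvPolynomial.sumAlgEquiv`; Zariski–Samuel II Ch. VII §1: «A[[X_1, …, X_n]] is isomorphic to A[[X_1, …, X_{n-1}]][[X_n]]»,
Bourbaki, Algèbre IV §4). [cite: ZariskiSamuel1960, Vol. II Ch. VII §1, Corollary of Theorem 4] -/
def sumAlgEquiv (σ τ R : Type*) [CommSemiring R] :
    MvPowerSeries (σ ⊕ τ) R ≃ₐ[R] MvPowerSeries σ (MvPowerSeries τ R) :=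
  AlgEquiv.ofRingEquiv (f :=
    { toFun := toIter
      invFun := ofIter
      left_inv := ofIter_toIter
      right_inv := toIter_ofIter
      map_mul' := toIter_mul
      map_add' := toIter_add }) (by
    intro r
    change toIter (algebraMap R (MvPowerSeries (σ ⊕ τ) R) r) = algebraMap R (MvPowerSeries σ (MvPowerSeries τ R)) r
    rw [MvPowerSeries.algebraMap_apply, MvPowerSeries.algebraMap_apply, MvPowerSeries.algebraMap_apply,
      Algebra.algebraMap_self, RingHom.id_apply, toIter_C])

/-- `sumAlgEquiv` is `toIter`. [cite: ZariskiSamuel1960, Vol. II Ch. VII §1, Corollary of Theorem 4] -/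
theorem sumAlgEquiv_apply (f : MvPowerSeries (σ ⊕ τ) R) : sumAlgEquiv σ τ R f = toIter f := rfl

/-- `sumAlgEquiv.symm` is `ofIter`. [cite: ZariskiSamuel1960, Vol. II Ch. VII §1, Corollary of Theorem 4] -/
theorem sumAlgEquiv_symm_apply (g : MvPowerSeries σ (MvPowerSeries τ R)) : (sumAlgEquiv σ τ R).symm g = ofIter g := rfl

/-- THE COEFFICIENT FORMULA for `sumAlgEquiv`. [cite: ZariskiSamuel1960, Vol. II Ch. VII §1, Corollary of Theorem 4] -/
@[simp] theorem coeff_coeff_sumAlgEquiv (f : MvPowerSeries (σ ⊕ τ) R) (d : σ →₀ ℕ) (e : τ →₀ ℕ) :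
    coeff e (coeff d (sumAlgEquiv σ τ R f)) = coeff (join d e) f := rfl

/-- Coefficients of the inverse. [cite: ZariskiSamuel1960, Vol. II Ch. VII §1, Corollary of Theorem 4] -/
@[simp] theorem coeff_sumAlgEquiv_symm (g : MvPowerSeries σ (MvPowerSeries τ R)) (n : σ ⊕ τ →₀ ℕ) :
    coeff n ((sumAlgEquiv σ τ R).symm g) = coeff (splitR n) (coeff (splitL n) g) := rfl

/-- `sumAlgEquiv` on monomials. [cite: ZariskiSamuel1960, Vol. II Ch. VII §1, Corollary of Theorem 4] -/
theorem sumAlgEquiv_monomial (d : σ →₀ ℕ) (e : τ →₀ ℕ) (r : R) :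
    sumAlgEquiv σ τ R (monomial (join d e) r) = monomial d (monomial e r) :=
  toIter_monomial d e r

/-- `sumAlgEquiv` on constants: `C r ↦ C (C r)`. [cite: ZariskiSamuel1960, Vol. II Ch. VII §1, Corollary of Theorem 4] -/
theorem sumAlgEquiv_C (r : R) : sumAlgEquiv σ τ R (C r) = C (C r) := toIter_C r

/-- `sumAlgEquiv` on a left variable: `X_i ↦ X_i`. [cite: ZariskiSamuel1960, Vol. II Ch. VII §1, Corollary of Theorem 4] -/
theorem sumAlgEquiv_X_inl (i : σ) : sumAlgEquiv σ τ R (X (Sum.inl i)) = X i := by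
  rw [X_def, X_def, ← join_single_zero, sumAlgEquiv_monomial, monomial_zero_one]

/-- `sumAlgEquiv` on a right variable: `Y_j ↦ C (Y_j)`. [cite: ZariskiSamuel1960, Vol. II Ch. VII §1, Corollary of Theorem 4] -/
theorem sumAlgEquiv_X_inr (j : τ) : sumAlgEquiv σ τ R (X (Sum.inr j)) = C (X j) := by
  rw [X_def, X_def, ← join_zero_single, sumAlgEquiv_monomial]
  rfl

/-- Constant coefficients: `(sumAlgEquiv f)(0)(0) = f(0)`. [cite: ZariskiSamuel1960, Vol. II Ch. VII §1, Corollary of Theorem 4] -/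
theorem constantCoeff_constantCoeff_sumAlgEquiv (f : MvPowerSeries (σ ⊕ τ) R) :
    constantCoeff (constantCoeff (sumAlgEquiv σ τ R f)) = constantCoeff f := by
  rw [← coeff_zero_eq_constantCoeff_apply, ← coeff_zero_eq_constantCoeff_apply, coeff_coeff_sumAlgEquiv,
    (join_eq_zero_iff (0 : σ →₀ ℕ) (0 : τ →₀ ℕ)).mpr ⟨rfl, rfl⟩, coeff_zero_eq_constantCoeff_apply]

/-! ### 3. The two block embeddings -/

/-- A series in the LEFT variables only: `sumAlgEquiv (rename inl g) = map C g` (constant coefficients). [cite: ZariskiSamuel1960, Vol. II Ch. VII §1, Corollary of Theorem 4] -/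
theorem sumAlgEquiv_rename_inl (g : MvPowerSeries σ R) :
    sumAlgEquiv σ τ R (rename (Function.Embedding.inl : σ ↪ σ ⊕ τ) g) = map (C : R →+* MvPowerSeries τ R) g := by
  classical
  ext d e
  rw [coeff_coeff_sumAlgEquiv, coeff_map]
  by_cases he : e = 0
  · subst he
    have h : join d (0 : τ →₀ ℕ) = embDomain (Function.Embedding.inl : σ ↪ σ ⊕ τ) d := by
      ext x; rcases x with i | j
      · exact (join_inl d 0 i).trans (embDomain_apply_self (Function.Embedding.inl : σ ↪ σ ⊕ τ) d i).symm
      · exact (join_inr d 0 j).trans (embDomain_notin_range (f := (Function.Embedding.inl : σ ↪ σ ⊕ τ))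
          (v := d) (a := Sum.inr j) (by simp)).symm
    rw [h, coeff_embDomain_rename, coeff_C, if_pos rfl]
  · rw [coeff_C, if_neg he, coeff_rename_eq_zero]
    rintro ⟨d', hd'⟩
    apply he
    ext j
    have h1 : mapDomain (Function.Embedding.inl : σ ↪ σ ⊕ τ) d' (Sum.inr j) = join d e (Sum.inr j) := by rw [hd']
    rw [join_inr, mapDomain_notin_range _ _ (by simp)] at h1
    exact h1.symm

/-- A series in the RIGHT variables only: `sumAlgEquiv (rename inr h) = C h`. [cite: ZariskiSamuel1960, Vol. II Ch. VII §1, Corollary of Theorem 4] -/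
theorem sumAlgEquiv_rename_inr (h : MvPowerSeries τ R) :
    sumAlgEquiv σ τ R (rename (Function.Embedding.inr : τ ↪ σ ⊕ τ) h) = C h := by
  classical
  ext d e
  rw [coeff_coeff_sumAlgEquiv, coeff_C]
  by_cases hd : d = 0
  · subst hd
    have hj : join (0 : σ →₀ ℕ) e = embDomain (Function.Embedding.inr : τ ↪ σ ⊕ τ) e := by
      ext x; rcases x with i | j
      · exact (join_inl 0 e i).trans (embDomain_notin_range (f := (Function.Embedding.inr : τ ↪ σ ⊕ τ))
          (v := e) (a := Sum.inl i) (by simp)).symm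
      · exact (join_inr 0 e j).trans (embDomain_apply_self (Function.Embedding.inr : τ ↪ σ ⊕ τ) e j).symm
    rw [if_pos rfl, hj, coeff_embDomain_rename]
  · rw [if_neg hd, map_zero, coeff_rename_eq_zero]
    rintro ⟨e', he'⟩
    apply hd
    ext i
    have h1 : mapDomain (Function.Embedding.inr : τ ↪ σ ⊕ τ) e' (Sum.inl i) = join d e (Sum.inl i) := by rw [he']
    rw [join_inl, mapDomain_notin_range _ _ (by simp)] at h1
    exact h1.symm

/-! ### 4. Orders -/

/-- THE `σ`-ADIC ORDER IS THE ORDER OVER `R⟦Y_τ⟧`: the weighted order of `f` with weight `1` on the `σ`-variables and `0`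
on the `τ`-variables equals the order of `sumAlgEquiv f` as a power series in the `σ`-variables over `R⟦Y_τ⟧` (finite
index types). [cite: ZariskiSamuel1960, Vol. II Ch. VII §1, Corollary of Theorem 4] -/
theorem weightedOrder_sumElim_eq_order_sumAlgEquiv [Fintype σ] [Fintype τ] (f : MvPowerSeries (σ ⊕ τ) R) :
    weightedOrder (Sum.elim (fun _ : σ => (1 : ℕ)) (fun _ : τ => 0)) f = (sumAlgEquiv σ τ R f).order := by
  apply le_antisymm
  · -- every `σ`-exponent `d` carrying a non-zero coefficient of `sumAlgEquiv f` carries some `join d e` of `f`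
    refine MvPowerSeries.le_order fun d hd => ?_
    by_contra hne
    obtain ⟨e, he⟩ : ∃ e, coeff e (coeff d (sumAlgEquiv σ τ R f)) ≠ 0 := by
      by_contra hall
      push Not at hall
      exact hne (MvPowerSeries.ext hall)
    rw [coeff_coeff_sumAlgEquiv] at he
    have h1 := weightedOrder_le (Sum.elim (fun _ : σ => (1 : ℕ)) (fun _ : τ => 0)) he
    rw [weight_sumElim_join] at h1
    exact absurd (lt_of_le_of_lt h1 hd) (lt_irrefl _)
  · refine MvPowerSeries.le_weightedOrder _ fun n hn => ?_
    rw [← join_split n, weight_sumElim_join] at hn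
    have h0 : coeff (splitL n) (sumAlgEquiv σ τ R f) = 0 := coeff_of_lt_order hn
    have h1 := congrArg (coeff (splitR n)) h0
    rw [coeff_coeff_sumAlgEquiv, join_split, map_zero] at h1
    exact h1

/-- The order of a power series is unchanged under an INJECTIVE change of coefficients. [cite: ZariskiSamuel1960, Vol. II Ch. VII §1, Corollary of Theorem 4] -/
theorem order_map_of_injective {S : Type*} [CommSemiring S] {ι : Type*} (φ : R →+* S) (hφ : Function.Injective φ)
    (g : MvPowerSeries ι R) : (map φ g).order = g.order := by
  refine le_antisymm ?_ (le_order_map φ)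
  refine MvPowerSeries.le_order fun d hd => ?_
  have h := coeff_of_lt_order hd
  rw [coeff_map] at h
  exact hφ (by rw [h, map_zero])

/-- Hence: for an injective `φ : R⟦Y_τ⟧ →+* K` (e.g. `τ` = one variable `t` and `K = Frac R⟦t⟧`), the `σ`-adic order of `f`
is the order of the `K`-series `map φ (sumAlgEquiv f)` — «order along `V(X_σ)` = order at the generic point». [cite: ZariskiSamuel1960, Vol. II Ch. VII §1, Corollary of Theorem 4] -/
theorem weightedOrder_sumElim_eq_order_map_sumAlgEquiv [Fintype σ] [Fintype τ] {K : Type*} [CommSemiring K]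
    (φ : MvPowerSeries τ R →+* K) (hφ : Function.Injective φ) (f : MvPowerSeries (σ ⊕ τ) R) :
    weightedOrder (Sum.elim (fun _ : σ => (1 : ℕ)) (fun _ : τ => 0)) f = (map φ (sumAlgEquiv σ τ R f)).order := by
  rw [order_map_of_injective φ hφ, weightedOrder_sumElim_eq_order_sumAlgEquiv]

end Literature.RingTheory.MvPowerSeries.SumEquiv

end
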